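import Literature.AlgebraicGeometry.Morphisms.SectionsBaseChangeThroughPrime
import Mathlib.RingTheory.LocalProperties.Exactness
import Mathlib.RingTheory.Localization.BaseChange
import HarnessLib

/-!
# `H⁰` commutes with every affine base change, given `H¹`-vanishing on every fibre

[cite: MumfordAV1970, §5, Corollary 3 (p. 53)]
[cite: Hartshorne1977, III Theorem 12.11 (p. 290)]
[cite: EGAIII2, 7.7.5 and 7.7.10]
[cite: AtiyahMacdonald1969, Ch. 3 Prop. 3.9 (p. 40)]

Sequel to ★ `Morphisms/SectionsBaseChangeThroughPrime` (the isomorphism for base changes through `Spec A_𝔭`, ONE prime)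
and ★ `Modules/ModuleSectionsFlatBaseChange` (flat base change): the GLOBALISATION over an affine base.  Setting:
`f : X → Spec A` proper and flat, `A` noetherian, `G` finite locally free on `X`, and for EVERY prime `𝔭` of `A` a cartesian
square `X_𝔭 = X ×_A κ(𝔭)` (any one, `HX 𝔭`) with `Ext¹_{𝒪_{X_𝔭}}(𝒪_{X_𝔭}, G|_{X_𝔭}) = 0`.  MAIN THEOREM
(`exists_tensor_secMod_top_linearEquiv_of_forall_prime`): for EVERY affine scheme `B′`, EVERY morphism `j : B′ → Spec A`
and every cartesian square `X′ = X ×_A B′ → B′`,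
**`Γ(B′, 𝒪) ⊗_{Γ(Spec A, 𝒪)} Γ(X, G) ≃ Γ(X′, G|_{X′})`, `b ⊗ t ↦ b · η(t)`** (linear over `Γ(B′, 𝒪)`) — cohomology and base
change in degree `0` (Mumford §5 Cor. 3 / Hartshorne III 12.11 / EGA III 7.7.5 II) in full over an affine noetherian
base.  This is the «ANY affine `W` over the affine `V`» input of ★ `Modules.isIso_pushforwardBaseChangeHom_of_charts`
(the (hbc) hypothesis of the (h6-d) chain `Morphisms/ContainmentRepOfPushforward`), at `V = Spec A`; the chart edition
over an arbitrary base follows by restriction.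

Proof.  `χ : b ⊗ t ↦ b · η(t)` is the base change `ηₗ.liftBaseChange Γ(B′)` of the `Γ(Spec A)`-linear map
`η : t ↦ η_k(t)` (linear because of the ring square `k♯ ∘ f♯ = g′♯ ∘ j♯`).  §1 (pure algebra,
`Literature.Algebra.Module.bijective_liftBaseChange_of_forall_maximal`, Atiyah–Macdonald Prop. 3.9 with Mathlib's
`bijective_of_isLocalized_maximal`, `tensorProduct_isLocalizedModule`, `AlgebraTensorModule.cancelBaseChange`): such a
base change is bijective as soon as, for every maximal `P ⊂ Γ(B′)`, some `Γ(B′)_P ⊗_{Γ(A)} Γ(X, G) ≃ Γ(B′)_P ⊗_{Γ(B′)} Γ(X′, G′)`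
sends `c ⊗ t ↦ c ⊗ η(t)`.  §2 (bookkeeping for the local bases `T = Spec Γ(B′)_P → B′` of an affine scheme: the ring map
on global sections is the localisation map conjugated by `ΓSpecIso`, hence `Γ(T, 𝒪)` IS a localisation of `Γ(B′, 𝒪)` at
`P` and `T → B′` is flat; and `T → B′ → Spec A` factors through `Spec A_𝔭 → Spec A`, `𝔭 = P ∩ A`, by
`Localization.localRingHom`).  §4, local step (`exists_linearEquiv_localBase`): with `X₃ = X′ ×_{B′} T`, ★
`exists_tensor_secMod_top_linearEquiv_through_prime` gives `Γ(T) ⊗_{Γ(A)} Γ(X, G) ≃ Γ(X₃, (k₃ ≫ k)^*G)` and ★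
`exists_tensor_secMod_top_linearEquiv_of_flat` gives `Γ(T) ⊗_{Γ(B′)} Γ(X′, k^*G) ≃ Γ(X₃, k₃^* k^*G)`; they are matched
along `(k₃ ≫ k)^*G ≅ k₃^* k^*G` (§3, Mathlib `Scheme.Modules.pullbackComp`; unit sections compose, ★
`pullbackComp_hom_app_unitSection`).

Everything is proved; no named facts; theorems only; no instance, notation or option beyond the file-level transparency
switch shared with its ★ predecessors.  Universe `Scheme.{0}`.  Elaboration notes (for successors working with sections
of pulled-back modules): the local step is stated with explicit binders in its own `section` — with section `variable`s
the core `unusedSectionVars` linter alone took ≈ 45 s on its proof term (whole file ≈ 9 s without); hypotheses are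
destructured only after `have` (never `obtain … := <term>`); identifications are consumed by explicitly instantiated
`Eq.trans` chains rather than `rw`.  Cell `hodgecm-mathlib`, F-DAG (h2) geometric glue, G8 (B-p19 (g15)); consumers:
B-p04 (g19)'s (h6-d) FILE D `Modules/PushforwardBaseChangeCharts`, and the chart edition G9.  HC_CM is proved only
modulo the 7 printed citations until rung 0 closes — nothing here bears on a summit statement.

## References

* D. Mumford, *Abelian Varieties*, TIFR Studies in Mathematics 5 (1970), §5, Cor. 3 (p. 53). [MumfordAV1970]
* R. Hartshorne, *Algebraic Geometry*, GTM 52 (1977), III Thm. 12.11 (p. 290). [Hartshorne1977]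
* A. Grothendieck, EGA III₂ (Publ. Math. IHÉS 17, 1963), 7.7.5, 7.7.10. [EGAIII2]
* M. F. Atiyah, I. G. Macdonald, *Introduction to Commutative Algebra* (1969), Ch. 3, Prop. 3.9 (p. 40). [AtiyahMacdonald1969]
-/

noncomputable section

set_option backward.isDefEq.respectTransparency false

open CategoryTheory CategoryTheory.Limits CategoryTheory.Abelian Opposite TopologicalSpace AlgebraicGeometry
open TensorProduct

/-! ## §1 Algebra: bijectivity of a map out of a base change is local at the maximal ideals of the new base -/

namespace Literature.Algebra.Module

/-- **Bijectivity of the base-changed map `B ⊗_R M → N`, `b ⊗ m ↦ b · η(m)`, is local at the maximal ideals of `B`**,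
in the form used for «cohomology and base change»: `η : M → N` an `R`-linear map into a `B`-module (`B` an `R`-algebra);
if for every maximal `P ⊂ B` there is a `B_P`-linear isomorphism `Ψ_P : B_P ⊗_R M ≃ B_P ⊗_B N` with
`Ψ_P (c ⊗ m) = c ⊗ η(m)` (`B_P` any localization of `B` at `P`), then `B ⊗_R M → N` is bijective (Atiyah–Macdonald
Prop. 3.9: injectivity and surjectivity of a `B`-linear map are checked after localising at every maximal ideal; and
`B_P ⊗_B (B ⊗_R M) = B_P ⊗_R M`, Mathlib `AlgebraTensorModule.cancelBaseChange`).  The localization data are instance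
families in Mathlib's `bijective_of_isLocalized_maximal` style; pass local ones by name (`(instAlgB := …)`).
[cite: AtiyahMacdonald1969, Ch. 3 Prop. 3.9 (p. 40)] -/
theorem bijective_liftBaseChange_of_forall_maximal {R B M N : Type*} [CommRing R] [CommRing B] [Algebra R B]
    [AddCommGroup M] [Module R M] [AddCommGroup N] [Module B N] [Module R N] [IsScalarTower R B N]
    (Bp : ∀ (P : Ideal B) [P.IsMaximal], Type*) [∀ (P : Ideal B) [P.IsMaximal], CommRing (Bp P)]
    [instAlgB : ∀ (P : Ideal B) [P.IsMaximal], Algebra B (Bp P)]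
    [instLoc : ∀ (P : Ideal B) [P.IsMaximal], IsLocalization.AtPrime (Bp P) P]
    [instAlgR : ∀ (P : Ideal B) [P.IsMaximal], Algebra R (Bp P)]
    [instTower : ∀ (P : Ideal B) [P.IsMaximal], IsScalarTower R B (Bp P)]
    (η : M →ₗ[R] N)
    (h : ∀ (P : Ideal B) [P.IsMaximal], ∃ Ψ : Bp P ⊗[R] M ≃ₗ[Bp P] Bp P ⊗[B] N,
      ∀ (c : Bp P) (m : M), Ψ (c ⊗ₜ[R] m) = c ⊗ₜ[B] η m) :
    Function.Bijective (η.liftBaseChange B) := by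
  refine bijective_of_isLocalized_maximal
    (fun P _ => Bp P ⊗[B] (B ⊗[R] M)) (fun P _ => TensorProduct.mk B (Bp P) (B ⊗[R] M) 1)
    (fun P _ => Bp P ⊗[B] N) (fun P _ => TensorProduct.mk B (Bp P) N 1) (η.liftBaseChange B) fun P _ => ?_
  obtain ⟨Ψ, hΨ⟩ := h P
  let C := TensorProduct.AlgebraTensorModule.cancelBaseChange R B (Bp P) (Bp P) M
  let Φ : Bp P ⊗[B] (B ⊗[R] M) ≃ₗ[Bp P] Bp P ⊗[B] N := C.trans Ψ
  have key : IsLocalizedModule.map P.primeCompl (TensorProduct.mk B (Bp P) (B ⊗[R] M) 1)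
      (TensorProduct.mk B (Bp P) N 1) (η.liftBaseChange B) = Φ.toLinearMap.restrictScalars B := by
    apply IsLocalizedModule.linearMap_ext P.primeCompl (TensorProduct.mk B (Bp P) (B ⊗[R] M) 1)
      (TensorProduct.mk B (Bp P) N 1)
    rw [IsLocalizedModule.map_comp]
    apply TensorProduct.AlgebraTensorModule.ext
    intro b m
    change (1 : Bp P) ⊗ₜ[B] (η.liftBaseChange B) (b ⊗ₜ[R] m) = Ψ (C ((1 : Bp P) ⊗ₜ[B] (b ⊗ₜ[R] m)))
    rw [TensorProduct.AlgebraTensorModule.cancelBaseChange_tmul, LinearMap.liftBaseChange_tmul, hΨ,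
      TensorProduct.smul_tmul]
  change Function.Bijective (IsLocalizedModule.map P.primeCompl (TensorProduct.mk B (Bp P) (B ⊗[R] M) 1)
      (TensorProduct.mk B (Bp P) N 1) (η.liftBaseChange B))
  rw [key]
  exact Φ.bijective

end Literature.Algebra.Module

/-! ## §2 The local bases `Spec Γ(B′)_P → B′` of an affine scheme: ring-level bookkeeping -/

namespace Literature.AlgebraicGeometry.Morphisms

open Literature.AlgebraicGeometry.Modules Literature.AlgebraicGeometry.HodgeTheory Literature.AlgebraicGeometry.Motives

section LocalBases

variable {B' : Scheme.{0}} [IsAffine B'] {Q : Type} [CommRing Q] (φ : Γ(B', ⊤) →+* Q)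

/-- For an affine `B′` and a ring map `φ : Γ(B′, 𝒪) → Q`, the morphism `Spec Q → Spec Γ(B′, 𝒪) ≅ B′` is `φ` on global
sections (conjugated by `ΓSpecIso`). [folklore] -/
private theorem appTop_SpecMap_comp_isoSpec_inv :
    (Spec.map (CommRingCat.ofHom φ) ≫ B'.isoSpec.inv).appTop =
      CommRingCat.ofHom φ ≫ (Scheme.ΓSpecIso (CommRingCat.of Q)).inv := by
  have h1 : B'.isoSpec.inv.appTop = (Scheme.ΓSpecIso Γ(B', ⊤)).inv := by
    change (inv B'.toSpecΓ).appTop = _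
    rw [Scheme.Hom.inv_appTop]
    simp only [Scheme.toSpecΓ_appTop, IsIso.Iso.inv_hom]
  rw [Scheme.Hom.comp_appTop, h1]
  exact (Scheme.ΓSpecIso_inv_naturality (CommRingCat.ofHom φ)).symm

/-- Elementwise form on `appLE ⊤ ⊤`: `(Spec Q → B′)♯(b) = ΓSpecIso⁻¹ (φ b)`. [folklore] -/
private theorem appLE_SpecMap_comp_isoSpec_inv_apply (b : Γ(B', ⊤)) :
    ((Spec.map (CommRingCat.ofHom φ) ≫ B'.isoSpec.inv).appLE ⊤ ⊤ le_top).hom b =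
      (Scheme.ΓSpecIso (CommRingCat.of Q)).inv (φ b) := by
  have e1 : (homOfLE (le_top : (⊤ : (Spec (CommRingCat.of Q)).Opens) ≤
      (Spec.map (CommRingCat.ofHom φ) ≫ B'.isoSpec.inv) ⁻¹ᵁ ⊤)) = 𝟙 ⊤ := Subsingleton.elim _ _
  change ((Spec.map (CommRingCat.ofHom φ) ≫ B'.isoSpec.inv).appTop ≫
    (Spec (CommRingCat.of Q)).presheaf.map (homOfLE le_top).op) b = _
  rw [e1, op_id]
  erw [CategoryTheory.Functor.map_id, Category.comp_id]
  rw [appTop_SpecMap_comp_isoSpec_inv]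
  rfl

/-- **`Γ(Spec Q, 𝒪)` is a localization of `Γ(B′, 𝒪)` at `S` when `Q` is**, for the algebra structure through the
morphism `Spec Q → B′` (transport of `IsLocalization` along `ΓSpecIso : Γ(Spec Q, 𝒪) ≅ Q`). [folklore] -/
private theorem isLocalization_Γ_SpecMap_comp_isoSpec_inv (S : Submonoid Γ(B', ⊤)) [Algebra Γ(B', ⊤) Q]
    [IsLocalization S Q] :
    letI := ((Spec.map (CommRingCat.ofHom (algebraMap Γ(B', ⊤) Q)) ≫ B'.isoSpec.inv).appLE ⊤ ⊤ le_top).hom.toAlgebra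
    IsLocalization S Γ(Spec (CommRingCat.of Q), ⊤) := by
  letI := ((Spec.map (CommRingCat.ofHom (algebraMap Γ(B', ⊤) Q)) ≫ B'.isoSpec.inv).appLE ⊤ ⊤ le_top).hom.toAlgebra
  let e : Q ≃ₐ[Γ(B', ⊤)] Γ(Spec (CommRingCat.of Q), ⊤) :=
    { (Scheme.ΓSpecIso (CommRingCat.of Q)).symm.commRingCatIsoToRingEquiv with
      commutes' := fun b => by
        change (Scheme.ΓSpecIso (CommRingCat.of Q)).inv (algebraMap Γ(B', ⊤) Q b) =
          ((Spec.map (CommRingCat.ofHom (algebraMap Γ(B', ⊤) Q)) ≫ B'.isoSpec.inv).appLE ⊤ ⊤ le_top).hom b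
        rw [appLE_SpecMap_comp_isoSpec_inv_apply] }
  exact IsLocalization.isLocalization_of_algEquiv S e

/-- The ring map on global sections of `Spec Q → B′` is flat when `φ` is. [folklore] -/
private theorem flat_appLE_SpecMap_comp_isoSpec_inv (hφ : φ.Flat) :
    ((Spec.map (CommRingCat.ofHom φ) ≫ B'.isoSpec.inv).appLE ⊤ ⊤ le_top).hom.Flat := by
  have h : ((Spec.map (CommRingCat.ofHom φ) ≫ B'.isoSpec.inv).appLE ⊤ ⊤ le_top).hom =
      (Scheme.ΓSpecIso (CommRingCat.of Q)).inv.hom.comp φ :=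
    RingHom.ext fun b => appLE_SpecMap_comp_isoSpec_inv_apply φ b
  rw [h]
  exact RingHom.Flat.comp hφ
    (RingHom.Flat.of_bijective (Scheme.ΓSpecIso (CommRingCat.of Q)).symm.commRingCatIsoToRingEquiv.bijective)

/-- **`Spec B′_P → B′ → Spec A` factors through `Spec A_𝔭 → Spec A`, `𝔭 = P ∩ A`**, via `Localization.localRingHom`:
both composites are `Spec` of `A → Γ(B′, 𝒪) → Γ(B′, 𝒪)_P`. [folklore] -/
private theorem SpecMap_localRingHom_comp_SpecMap_algebraMap {A : Type} [CommRing A]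
    (j : B' ⟶ Spec (CommRingCat.of A)) (φ₀ : A →+* Γ(B', ⊤))
    (hφ₀ : CommRingCat.ofHom φ₀ = (Scheme.ΓSpecIso (CommRingCat.of A)).inv ≫ j.appTop)
    (P : Ideal Γ(B', ⊤)) [P.IsPrime] :
    Spec.map (CommRingCat.ofHom (Localization.localRingHom (P.comap φ₀) P φ₀ rfl)) ≫
        Spec.map (CommRingCat.ofHom (algebraMap A (Localization.AtPrime (P.comap φ₀)))) =
      (Spec.map (CommRingCat.ofHom (algebraMap Γ(B', ⊤) (Localization.AtPrime P))) ≫ B'.isoSpec.inv) ≫ j := by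
  have hl : Spec.map (CommRingCat.ofHom (Localization.localRingHom (P.comap φ₀) P φ₀ rfl)) ≫
      Spec.map (CommRingCat.ofHom (algebraMap A (Localization.AtPrime (P.comap φ₀)))) =
      Spec.map (CommRingCat.ofHom ((algebraMap Γ(B', ⊤) (Localization.AtPrime P)).comp φ₀)) := by
    rw [← Spec.map_comp, ← CommRingCat.ofHom_comp]
    congr 2
    exact RingHom.ext fun a => Localization.localRingHom_to_map (P.comap φ₀) P φ₀ rfl a
  have hr : (Spec.map (CommRingCat.ofHom (algebraMap Γ(B', ⊤) (Localization.AtPrime P))) ≫ B'.isoSpec.inv) ≫ j =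
      Spec.map (CommRingCat.ofHom ((algebraMap Γ(B', ⊤) (Localization.AtPrime P)).comp φ₀)) := by
    rw [Category.assoc, ← Scheme.isoSpec_inv_naturality j, Scheme.isoSpec_Spec_inv, ← Spec.map_comp, ← Spec.map_comp,
      ← hφ₀, ← CommRingCat.ofHom_comp]
  rw [hl, hr]

end LocalBases

/-! ## §3 Transport of global sections along an isomorphism of modules -/

section Transport

variable {Y : Scheme.{0}} {R : Type} [CommRing R] (ρ : R →+* Γ(Y, ⊤)) {M N : Y.Modules} (φ : M ⟶ N) (ψ : N ⟶ M)
  (h₁ : φ ≫ ψ = 𝟙 M) (h₂ : ψ ≫ φ = 𝟙 N)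

include h₁ h₂ in
/-- Mutually inverse morphisms `φ : M ⟶ N`, `ψ : N ⟶ M` of `𝒪_Y`-modules induce an `R`-linear equivalence of the modules
of global sections (`R` acting through `ρ : R → Γ(Y, 𝒪)`), `x ↦ φ(x)` (stated for a morphism pair rather than an `Iso`, so
that a consumer's `α.inv.app G` enters verbatim). [folklore] -/
private theorem exists_secMod_linearEquiv_of_inverse :
    ∃ L : SecMod M ρ ⊤ ≃ₗ[R] SecMod N ρ ⊤,
      ∀ x, SecMod.val (L := N) (ρ := ρ) (L x) = φ.app ⊤ (SecMod.val (L := M) (ρ := ρ) x) := by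
  refine ⟨{ toFun := fun x => SecMod.mk (ρ := ρ) (φ.app ⊤ (SecMod.val (L := M) (ρ := ρ) x))
            invFun := fun y => SecMod.mk (ρ := ρ) (ψ.app ⊤ (SecMod.val (L := N) (ρ := ρ) y))
            map_add' := fun x y => by
              apply SecMod.val_injective (L := N) (ρ := ρ)
              change φ.app ⊤ (SecMod.val (L := M) (ρ := ρ) x + SecMod.val (L := M) (ρ := ρ) y) = _
              rw [map_add]
              rfl
            map_smul' := fun c x => by
              apply SecMod.val_injective (L := N) (ρ := ρ)
              change φ.app ⊤ (toSections ρ ⊤ c • SecMod.val (L := M) (ρ := ρ) x) =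
                toSections ρ ⊤ c • φ.app ⊤ (SecMod.val (L := M) (ρ := ρ) x)
              rw [Scheme.Modules.Hom.app_smul]
            left_inv := fun x => by
              apply SecMod.val_injective (L := M) (ρ := ρ)
              change (φ ≫ ψ).app ⊤ (SecMod.val (L := M) (ρ := ρ) x) = _
              rw [h₁]
              rfl
            right_inv := fun y => by
              apply SecMod.val_injective (L := N) (ρ := ρ)
              change (ψ ≫ φ).app ⊤ (SecMod.val (L := N) (ρ := ρ) y) = _
              rw [h₂]
              rfl }, fun x => rfl⟩

end Transport

/-! ## §4 Cohomology and base change in degree `0` over an affine base, from `H¹`-vanishing on every fibre -/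

section LocalStep

/-! ### The local step at a maximal ideal of `Γ(B′, 𝒪)` (explicit binders and no section variables, which keeps the
`unusedSectionVars` linter — very slow on a proof term of this size — out of this declaration) -/

/-- **The local step at a maximal ideal `P ⊂ Γ(B′, 𝒪)`**: over the local base `T = Spec Γ(B′)_P → B′` (with ANY
cartesian square `H₃ : X₃ = X′ ×_{B′} T`), `Γ(T) ⊗_{Γ(Spec A)} Γ(X, G) ≃ Γ(T) ⊗_{Γ(B′)} Γ(X′, k^*G)`, `c ⊗ t ↦ c ⊗ η_k(t)`
(linear over `Γ(T, 𝒪)`; the algebra structures are those of `T → B′` and `T → B′ → Spec A` on global sections).  Proof: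
`T → B′ → Spec A` factors through `Spec A_𝔭`, `𝔭 = P ∩ A` (§2), so ★ `exists_tensor_secMod_top_linearEquiv_through_prime`
gives `Γ(T) ⊗_{Γ(A)} Γ(X, G) ≃ Γ(X₃, (k₃ ≫ k)^*G)`; ★ `exists_tensor_secMod_top_linearEquiv_of_flat` (flat base change
`T → B′`) gives `Γ(T) ⊗_{Γ(B′)} Γ(X′, k^*G) ≃ Γ(X₃, k₃^* k^* G)`; and `(k₃ ≫ k)^*G ≅ k₃^* k^*G` (§3, unit sections compose).
[cite: MumfordAV1970, §5 Cor. 3 (p. 53)] [cite: Hartshorne1977, III Thm. 12.11 (p. 290)] -/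
private theorem exists_linearEquiv_localBase {A : Type} [CommRing A] [IsNoetherianRing A] {X : Scheme.{0}}
    (f : X ⟶ Spec (CommRingCat.of A)) [IsProper f] [Flat f] (G : X.Modules) (hL : IsFiniteLocallyFree G)
    {X₀ : ∀ (𝔭 : Ideal A) [𝔭.IsPrime], Scheme.{0}} (iX : ∀ (𝔭 : Ideal A) [𝔭.IsPrime], X₀ 𝔭 ⟶ X)
    (f₀ : ∀ (𝔭 : Ideal A) [𝔭.IsPrime], X₀ 𝔭 ⟶ Spec (CommRingCat.of 𝔭.ResidueField))
    (HX : ∀ (𝔭 : Ideal A) [𝔭.IsPrime],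
      IsPullback (iX 𝔭) (f₀ 𝔭) f (Spec.map (CommRingCat.ofHom (algebraMap A 𝔭.ResidueField))))
    (hvan : ∀ (𝔭 : Ideal A) [𝔭.IsPrime],
      Subsingleton (Ext.{1} (unitModule (X₀ 𝔭)) ((Scheme.Modules.pullback (iX 𝔭)).obj G) 1))
    {X' B' : Scheme.{0}} [IsAffine B'] {g' : X' ⟶ B'} {k : X' ⟶ X} {j : B' ⟶ Spec (CommRingCat.of A)}
    (H : IsPullback k g' f j) (P : Ideal Γ(B', ⊤)) [P.IsMaximal] {X₃ : Scheme.{0}} {k₃ : X₃ ⟶ X'}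
    {g₃ : X₃ ⟶ Spec (CommRingCat.of (Localization.AtPrime P))}
    (H₃ : IsPullback k₃ g₃ g'
      (Spec.map (CommRingCat.ofHom (algebraMap Γ(B', ⊤) (Localization.AtPrime P))) ≫ B'.isoSpec.inv)) :
    letI := ((Spec.map (CommRingCat.ofHom (algebraMap Γ(B', ⊤) (Localization.AtPrime P))) ≫ B'.isoSpec.inv).appLE ⊤ ⊤
      le_top).hom.toAlgebra
    letI := (((Spec.map (CommRingCat.ofHom (algebraMap Γ(B', ⊤) (Localization.AtPrime P))) ≫ B'.isoSpec.inv) ≫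
      j).appLE ⊤ ⊤ le_top).hom.toAlgebra
    ∃ Ψ : Γ(Spec (CommRingCat.of (Localization.AtPrime P)), ⊤) ⊗[Γ(Spec (CommRingCat.of A), ⊤)]
          SecMod G f.appTop.hom ⊤ ≃ₗ[Γ(Spec (CommRingCat.of (Localization.AtPrime P)), ⊤)]
        Γ(Spec (CommRingCat.of (Localization.AtPrime P)), ⊤) ⊗[Γ(B', ⊤)]
          SecMod ((Scheme.Modules.pullback k).obj G) g'.appTop.hom ⊤,
      ∀ (c : Γ(Spec (CommRingCat.of (Localization.AtPrime P)), ⊤)) (t : SecMod G f.appTop.hom ⊤),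
        Ψ (c ⊗ₜ t) = c ⊗ₜ SecMod.mk (ρ := g'.appTop.hom) (unitSectionLE k G (V := ⊤) (U := ⊤) le_top
          (SecMod.val (L := G) (ρ := f.appTop.hom) t)) := by
  letI := ((Spec.map (CommRingCat.ofHom (algebraMap Γ(B', ⊤) (Localization.AtPrime P))) ≫ B'.isoSpec.inv).appLE ⊤ ⊤
    le_top).hom.toAlgebra
  letI := (((Spec.map (CommRingCat.ofHom (algebraMap Γ(B', ⊤) (Localization.AtPrime P))) ≫ B'.isoSpec.inv) ≫
    j).appLE ⊤ ⊤ le_top).hom.toAlgebra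
  -- pulled-back unit sections on `⊤`, and their composition `Φ⁻¹(η_{n ≫ k}(t)) = η_n(η_k(t))`
  have hηunit : ∀ {Y Z : Scheme.{0}} (h : Y ⟶ Z) (M : Z.Modules) (m : Γ(M, ⊤)),
      unitSectionLE h M (V := ⊤) (U := ⊤) le_top m = unitSection h M ⊤ m := by
    intro Y Z h M m
    have e1 : (homOfLE (le_top : (⊤ : Y.Opens) ≤ h ⁻¹ᵁ ⊤)) = 𝟙 ⊤ := Subsingleton.elim _ _
    unfold unitSectionLE
    rw [e1, op_id]
    erw [CategoryTheory.Functor.map_id]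
    rfl
  -- the comparison `φ : (k₃ ≫ k)^* G ⟶ k₃^* k^* G` and its inverse `ψ`, as opaque morphisms between modules written in
  -- applied form `k₃^*(k^* G)` (rather than `(pullback k ⋙ pullback k₃).obj G`), with the two facts about them that are
  -- used: `ψ ≫ φ = 𝟙` and `ψ(η_{k₃}(η_k(m))) = η_{k₃ ≫ k}(m)`; the defeqs `(pullback k ⋙ pullback k₃).obj G = k₃^* k^* G`
  -- and `k₃ ⁻¹ᵁ (k ⁻¹ᵁ ⊤) = ⊤` are thus only checked in the one-line proofs of `hφψ`, `hψφ`, `hηψ`, on small terms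
  have exφ : ∃ φ : (Scheme.Modules.pullback (k₃ ≫ k)).obj G ⟶
      (Scheme.Modules.pullback k₃).obj ((Scheme.Modules.pullback k).obj G),
      φ = (Scheme.Modules.pullbackComp k₃ k).inv.app G :=
    ⟨_, rfl⟩
  have exψ : ∃ ψ : (Scheme.Modules.pullback k₃).obj ((Scheme.Modules.pullback k).obj G) ⟶
      (Scheme.Modules.pullback (k₃ ≫ k)).obj G, ψ = (Scheme.Modules.pullbackComp k₃ k).hom.app G :=
    ⟨_, rfl⟩
  obtain ⟨φ, hφ⟩ := exφ
  obtain ⟨ψ, hψ⟩ := exψ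
  have hφψ : φ ≫ ψ = 𝟙 _ := by
    rw [hφ, hψ]
    exact (Scheme.Modules.pullbackComp k₃ k).inv_hom_id_app G
  have hψφ : ψ ≫ φ = 𝟙 _ := by
    rw [hφ, hψ]
    exact (Scheme.Modules.pullbackComp k₃ k).hom_inv_id_app G
  have hid : ∀ y : Γ((Scheme.Modules.pullback k₃).obj ((Scheme.Modules.pullback k).obj G), ⊤),
      φ.app ⊤ (ψ.app ⊤ y) = y := by
    intro y
    change (ψ ≫ φ).app ⊤ y = y
    rw [hψφ]
    rfl
  have hηψ : ∀ m : Γ(G, ⊤),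
      ψ.app ⊤ (unitSectionLE k₃ ((Scheme.Modules.pullback k).obj G) (V := ⊤) (U := ⊤) le_top
        (unitSectionLE k G (V := ⊤) (U := ⊤) le_top m)) = unitSectionLE (k₃ ≫ k) G (V := ⊤) (U := ⊤) le_top m := by
    intro m
    rw [hψ, hηunit, hηunit, hηunit]
    exact pullbackComp_hom_app_unitSection k G k₃ ⊤ m
  -- the big square over `T → B' → Spec A`
  have Hbig : IsPullback (k₃ ≫ k) g₃ f
      ((Spec.map (CommRingCat.ofHom (algebraMap Γ(B', ⊤) (Localization.AtPrime P))) ≫ B'.isoSpec.inv) ≫ j) :=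
    H₃.paste_horiz H
  -- (1) flat base change along `T → B'`: `Γ(T) ⊗_{Γ(B')} Γ(X', k^*G) ≃ Γ(X₃, k₃^* k^* G)`
  have hflat : ((Spec.map (CommRingCat.ofHom (algebraMap Γ(B', ⊤) (Localization.AtPrime P))) ≫
      B'.isoSpec.inv).appLE ⊤ ⊤ le_top).hom.Flat := by
    refine flat_appLE_SpecMap_comp_isoSpec_inv (algebraMap Γ(B', ⊤) (Localization.AtPrime P)) ?_
    rw [RingHom.flat_algebraMap_iff]
    exact IsLocalization.flat (Localization.AtPrime P) P.primeCompl
  haveI : IsProper g' := IsProper.isStableUnderBaseChange.of_isPullback H (inferInstanceAs (IsProper f))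
  -- (`have h := …; obtain pat := h` rather than `obtain pat := <term>`: destructuring a non-hypothesis term makes `rcases`
  -- generalise it first, which was observed to time out on goals of this size)
  have hc := exists_finite_affine_cover_cechOpen g'
  obtain ⟨ι, _, _, U, hcov, hUa⟩ := hc
  have hLk : IsFiniteLocallyFree ((Scheme.Modules.pullback k).obj G) := hL.pullback k
  haveI := hLk.isVectorBundle.1
  have hGk : IsAffineLocalizing ((Scheme.Modules.pullback k).obj G) := IsAffineLocalizing.of_isQuasicoherent _
  have hE₁' :=
    exists_tensor_secMod_top_linearEquiv_of_flat H₃ U hcov hUa ((Scheme.Modules.pullback k).obj G) hGk hflat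
  obtain ⟨E₁, hE₁⟩ := hE₁'
  -- (2) through the prime `𝔭 = P ∩ A`: `Γ(T) ⊗_{Γ(A)} Γ(X, G) ≃ Γ(X₃, (k₃ ≫ k)^* G)`
  let φ₀ : A →+* Γ(B', ⊤) := ((Scheme.ΓSpecIso (CommRingCat.of A)).inv ≫ j.appTop).hom
  have hE₂' := exists_tensor_secMod_top_linearEquiv_through_prime f G hL (P.comap φ₀) (HX (P.comap φ₀))
    (hvan (P.comap φ₀)) (Spec.map (CommRingCat.ofHom (Localization.localRingHom (P.comap φ₀) P φ₀ rfl)))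
    (SpecMap_localRingHom_comp_SpecMap_algebraMap j φ₀ rfl P) Hbig
  obtain ⟨E₂, hE₂⟩ := hE₂'
  -- (3) transport along `(k₃ ≫ k)^* G ≅ k₃^* k^* G`, and assembly `Ψ := E₂ ≫ L ≫ E₁⁻¹`
  have hL₃ := exists_secMod_linearEquiv_of_inverse g₃.appTop.hom φ ψ hφψ hψφ
  obtain ⟨L, hL'⟩ := hL₃
  refine ⟨E₂.trans (L.trans E₁.symm), fun c t => ?_⟩
  -- (explicit `Eq.trans` chain rather than `rw [hE₂, hE₁, hL']`: rewriting was observed to time out here, `kabstract`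
  -- comparing non-matching candidates up to `whnf` of sections of pulled-back modules)
  have h2 := hE₂ c t
  have h1 := hE₁ c (SecMod.mk (ρ := g'.appTop.hom)
    (unitSectionLE k G (V := ⊤) (U := ⊤) le_top (SecMod.val (L := G) (ρ := f.appTop.hom) t)))
  rw [LinearEquiv.trans_apply, LinearEquiv.trans_apply, LinearEquiv.symm_apply_eq]
  refine (congrArg L h2).trans (Eq.trans ?_ h1.symm)
  refine (map_smul L c _).trans ?_
  congr 1
  apply SecMod.val_injective (L := (Scheme.Modules.pullback k₃).obj ((Scheme.Modules.pullback k).obj G))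
    (ρ := g₃.appTop.hom)
  refine (hL' _).trans ?_
  -- unit sections compose: `φ(η_{k₃ ≫ k}(t)) = φ(ψ(η_{k₃}(η_k(t)))) = η_{k₃}(η_k(t))` (all sections read on `⊤` via
  -- `unitSectionLE`, so that no `k₃ ⁻¹ᵁ ⊤`-versus-`⊤` defeq is left to the final unification)
  rw [SecMod.val_mk, SecMod.val_mk, SecMod.val_mk, ← hηψ]
  exact hid _

end LocalStep

section FibrewiseVanishing

variable {A : Type} [CommRing A] [IsNoetherianRing A] {X : Scheme.{0}} (f : X ⟶ Spec (CommRingCat.of A))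
  [IsProper f] [Flat f] (G : X.Modules) (hL : IsFiniteLocallyFree G)
  {X₀ : ∀ (𝔭 : Ideal A) [𝔭.IsPrime], Scheme.{0}} (iX : ∀ (𝔭 : Ideal A) [𝔭.IsPrime], X₀ 𝔭 ⟶ X)
  (f₀ : ∀ (𝔭 : Ideal A) [𝔭.IsPrime], X₀ 𝔭 ⟶ Spec (CommRingCat.of 𝔭.ResidueField))
  (HX : ∀ (𝔭 : Ideal A) [𝔭.IsPrime],
    IsPullback (iX 𝔭) (f₀ 𝔭) f (Spec.map (CommRingCat.ofHom (algebraMap A 𝔭.ResidueField))))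
  (hvan : ∀ (𝔭 : Ideal A) [𝔭.IsPrime],
    Subsingleton (Ext.{1} (unitModule (X₀ 𝔭)) ((Scheme.Modules.pullback (iX 𝔭)).obj G) 1))
  {X' B' : Scheme.{0}} [IsAffine B'] {g' : X' ⟶ B'} {k : X' ⟶ X} {j : B' ⟶ Spec (CommRingCat.of A)}
  (H : IsPullback k g' f j)

include hL HX hvan H in
/-- **`H⁰` COMMUTES WITH EVERY AFFINE BASE CHANGE, given `H¹`-vanishing on EVERY fibre** (Mumford, *Abelian
Varieties*, §5 Cor. 3; Hartshorne III Thm. 12.11; EGA III 7.7.5 II — in degree `0`, over an arbitrary affine noetherian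
base, for ALL affine base changes): `f : X → Spec A` proper and flat, `A` noetherian, `G` finite locally free on `X`,
`X_𝔭 = X ×_A κ(𝔭)` (any cartesian squares `HX`, one for each prime `𝔭` of `A`) with `Ext¹(𝒪_{X_𝔭}, G|_{X_𝔭}) = 0` for
every prime `𝔭`; `B′` ANY affine scheme, `j : B′ → Spec A` ANY morphism, `X′ = X ×_A B′` (any cartesian square `H`).
Then **`Γ(B′, 𝒪) ⊗_{Γ(Spec A, 𝒪)} Γ(X, G) ≃ Γ(X′, G|_{X′})`** linearly over `Γ(B′, 𝒪)`, `b ⊗ t ↦ b · η(t)` — stated as: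
such a linear equivalence exists, AND every `Γ(B′, 𝒪)`-linear map with these values on pure tensors is bijective (the form
a consumer holding his own base-change map, e.g. `β_W` of ★ `Modules/PushforwardBaseChangeCharts`, applies).  Proof:
`χ : b ⊗ t ↦ b · η(t)` is the base change of the `Γ(Spec A)`-linear `η : t ↦ η_k(t)` (the ring square
`k♯ ∘ f♯ = g′♯ ∘ j♯` makes `η` linear), and it is bijective by §1 (`bijective_liftBaseChange_of_forall_maximal`) and the
local step `exists_linearEquiv_localBase` at every maximal `P ⊂ Γ(B′, 𝒪)` over `X′ ×_{B′} Spec Γ(B′)_P`.  This is the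
«any affine `W` over the affine `V = Spec A`» input of ★ `Modules.isIso_pushforwardBaseChangeHom_of_charts`.
[cite: MumfordAV1970, §5 Cor. 3 (p. 53)] [cite: Hartshorne1977, III Thm. 12.11 (p. 290)] [cite: EGAIII2, 7.7.5] -/
theorem exists_tensor_secMod_top_linearEquiv_of_forall_prime :
    letI := (j.appLE ⊤ ⊤ le_top).hom.toAlgebra
    (∃ E : Γ(B', ⊤) ⊗[Γ(Spec (CommRingCat.of A), ⊤)] SecMod G f.appTop.hom ⊤ ≃ₗ[Γ(B', ⊤)]
        SecMod ((Scheme.Modules.pullback k).obj G) g'.appTop.hom ⊤,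
      ∀ (b : Γ(B', ⊤)) (t : SecMod G f.appTop.hom ⊤),
        E (b ⊗ₜ t) = b • SecMod.mk (ρ := g'.appTop.hom) (unitSectionLE k G (V := ⊤) (U := ⊤) le_top
          (SecMod.val (L := G) (ρ := f.appTop.hom) t))) ∧
    ∀ F : Γ(B', ⊤) ⊗[Γ(Spec (CommRingCat.of A), ⊤)] SecMod G f.appTop.hom ⊤ →ₗ[Γ(B', ⊤)]
        SecMod ((Scheme.Modules.pullback k).obj G) g'.appTop.hom ⊤,
      (∀ (b : Γ(B', ⊤)) (t : SecMod G f.appTop.hom ⊤),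
        F (b ⊗ₜ t) = b • SecMod.mk (ρ := g'.appTop.hom) (unitSectionLE k G (V := ⊤) (U := ⊤) le_top
          (SecMod.val (L := G) (ρ := f.appTop.hom) t))) → Function.Bijective F := by
  letI algRB : Algebra Γ(Spec (CommRingCat.of A), ⊤) Γ(B', ⊤) := (j.appLE ⊤ ⊤ le_top).hom.toAlgebra
  -- the `Γ(Spec A)`-module structure on `Γ(X', k^*G)` through `j♯`, and the scalar tower
  letI modRN : Module Γ(Spec (CommRingCat.of A), ⊤) (SecMod ((Scheme.Modules.pullback k).obj G) g'.appTop.hom ⊤) :=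
    Module.compHom _ (j.appLE ⊤ ⊤ le_top).hom
  haveI : IsScalarTower Γ(Spec (CommRingCat.of A), ⊤) Γ(B', ⊤)
      (SecMod ((Scheme.Modules.pullback k).obj G) g'.appTop.hom ⊤) :=
    ⟨fun a c x => mul_smul ((j.appLE ⊤ ⊤ le_top).hom a) c x⟩
  -- the ring square on global sections: `k♯ ∘ f♯ = g'♯ ∘ j♯`
  have hsq : ∀ a : Γ(Spec (CommRingCat.of A), ⊤),
      (k.appLE ⊤ ⊤ le_top).hom ((f.appLE ⊤ ⊤ le_top).hom a) =
        (g'.appLE ⊤ ⊤ le_top).hom ((j.appLE ⊤ ⊤ le_top).hom a) := by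
    intro a
    have h₁ := congrArg (fun φ : Γ(Spec (CommRingCat.of A), ⊤) ⟶ Γ(X', ⊤) => φ a)
      (Scheme.Hom.appLE_comp_appLE k f ⊤ ⊤ ⊤ le_top le_top)
    have h₂ := congrArg (fun φ : Γ(Spec (CommRingCat.of A), ⊤) ⟶ Γ(X', ⊤) => φ a)
      (Scheme.Hom.appLE_comp_appLE g' j ⊤ ⊤ ⊤ le_top le_top)
    simp only [CommRingCat.comp_apply] at h₁ h₂
    rw [h₁, h₂]
    simp only [H.w]
  -- `η : Γ(X, G) → Γ(X', k^*G)` as a `Γ(Spec A)`-linear map; `χ := ηₗ.liftBaseChange Γ(B')` is `b ⊗ t ↦ b · η(t)`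
  let ηₗ : SecMod G f.appTop.hom ⊤ →ₗ[Γ(Spec (CommRingCat.of A), ⊤)]
      SecMod ((Scheme.Modules.pullback k).obj G) g'.appTop.hom ⊤ :=
    { toFun := fun t => SecMod.mk (ρ := g'.appTop.hom) (unitSectionLE k G (V := ⊤) (U := ⊤) le_top
        (SecMod.val (L := G) (ρ := f.appTop.hom) t))
      map_add' := fun t t' => by
        apply SecMod.val_injective (L := (Scheme.Modules.pullback k).obj G) (ρ := g'.appTop.hom)
        change unitSectionLE k G (V := ⊤) (U := ⊤) le_top
          (SecMod.val (L := G) (ρ := f.appTop.hom) t + SecMod.val (L := G) (ρ := f.appTop.hom) t') = _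
        rw [unitSectionLE_add]
        rfl
      map_smul' := fun a t => by
        apply SecMod.val_injective (L := (Scheme.Modules.pullback k).obj G) (ρ := g'.appTop.hom)
        change unitSectionLE k G (V := ⊤) (U := ⊤) le_top
            (toSections f.appTop.hom ⊤ a • SecMod.val (L := G) (ρ := f.appTop.hom) t) =
          toSections g'.appTop.hom ⊤ ((j.appLE ⊤ ⊤ le_top).hom a) •
            unitSectionLE k G (V := ⊤) (U := ⊤) le_top (SecMod.val (L := G) (ρ := f.appTop.hom) t)
        rw [unitSectionLE_smul, toSections_appTop, toSections_appTop, ← hsq a] }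
  -- `χ` is bijective: §1 over the local bases `Spec Γ(B')_P → B'` at the maximal ideals `P` of `Γ(B')` (the instance
  -- families are passed by name and INLINE, so that once `β`-reduced they are the `letI` algebras of the local step)
  have hbij : Function.Bijective (ηₗ.liftBaseChange Γ(B', ⊤)) :=
    Literature.Algebra.Module.bijective_liftBaseChange_of_forall_maximal
      (fun (P : Ideal Γ(B', ⊤)) _ => Γ(Spec (CommRingCat.of (Localization.AtPrime P)), ⊤))
      (instAlgB := fun (P : Ideal Γ(B', ⊤)) _ =>
        ((Spec.map (CommRingCat.ofHom (algebraMap Γ(B', ⊤) (Localization.AtPrime P))) ≫ B'.isoSpec.inv).appLE ⊤ ⊤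
          le_top).hom.toAlgebra)
      (instLoc := fun (P : Ideal Γ(B', ⊤)) _ => isLocalization_Γ_SpecMap_comp_isoSpec_inv (B' := B') P.primeCompl)
      (instAlgR := fun (P : Ideal Γ(B', ⊤)) _ =>
        (((Spec.map (CommRingCat.ofHom (algebraMap Γ(B', ⊤) (Localization.AtPrime P))) ≫ B'.isoSpec.inv) ≫ j).appLE
          ⊤ ⊤ le_top).hom.toAlgebra)
      (instTower := fun (P : Ideal Γ(B', ⊤)) _ => by
        letI : Algebra Γ(B', ⊤) Γ(Spec (CommRingCat.of (Localization.AtPrime P)), ⊤) :=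
          ((Spec.map (CommRingCat.ofHom (algebraMap Γ(B', ⊤) (Localization.AtPrime P))) ≫ B'.isoSpec.inv).appLE ⊤ ⊤
            le_top).hom.toAlgebra
        letI : Algebra Γ(Spec (CommRingCat.of A), ⊤) Γ(Spec (CommRingCat.of (Localization.AtPrime P)), ⊤) :=
          (((Spec.map (CommRingCat.ofHom (algebraMap Γ(B', ⊤) (Localization.AtPrime P))) ≫ B'.isoSpec.inv) ≫ j).appLE
            ⊤ ⊤ le_top).hom.toAlgebra
        exact IsScalarTower.of_algebraMap_eq' (by
          change (((Spec.map (CommRingCat.ofHom (algebraMap Γ(B', ⊤) (Localization.AtPrime P))) ≫ B'.isoSpec.inv) ≫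
              j).appLE ⊤ ⊤ le_top).hom =
            ((Spec.map (CommRingCat.ofHom (algebraMap Γ(B', ⊤) (Localization.AtPrime P))) ≫ B'.isoSpec.inv).appLE ⊤ ⊤
              le_top).hom.comp (j.appLE ⊤ ⊤ le_top).hom
          rw [← CommRingCat.hom_comp, Scheme.Hom.appLE_comp_appLE]))
      ηₗ fun P _ => exists_linearEquiv_localBase f G hL iX f₀ HX hvan H P (IsPullback.of_hasPullback g' _)
  have hχ : ∀ (b : Γ(B', ⊤)) (t : SecMod G f.appTop.hom ⊤), ηₗ.liftBaseChange Γ(B', ⊤) (b ⊗ₜ t) =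
      b • SecMod.mk (ρ := g'.appTop.hom) (unitSectionLE k G (V := ⊤) (U := ⊤) le_top
        (SecMod.val (L := G) (ρ := f.appTop.hom) t)) := fun b t => by
    rw [LinearMap.liftBaseChange_tmul]
    rfl
  refine ⟨⟨LinearEquiv.ofBijective _ hbij, fun b t => by rw [LinearEquiv.ofBijective_apply, hχ]⟩, fun F hF => ?_⟩
  -- any `Γ(B')`-linear `F` with the same values on pure tensors IS `χ`
  have hFχ : (F : _ → _) = ηₗ.liftBaseChange Γ(B', ⊤) := by
    funext x
    induction x using TensorProduct.induction_on with
    | zero => rw [map_zero, map_zero]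
    | tmul b t => rw [hF, hχ]
    | add x y hx hy => rw [map_add, map_add, hx, hy]
  rw [hFχ]
  exact hbij

end FibrewiseVanishing

end Literature.AlgebraicGeometry.Morphisms

end
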